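import Summits.KontsevichZagierPeriods.Zeta5Search.LaiSweepShard

/-!
# `κ₃` sweep certificate — shard file 058 of 127 (shards 406–412 of 889)

HONEST FRAMING. Systematic search; no irrationality claim unless certified. This file only checks,
by `decide +kernel`, shards 406–412 of the order-cell sweep of the `κ₃` point `(74, 2180, 444; δ74)`
(engine `LaiSweepEngine`, soundness `LaiSweepJump/Free/Eval/Shard/Kappa3`; a shard is `⟨regime, n,
p, q, p', q', Lo, Up⟩`: `n` cells from `p/q` to `p'/q'` with integer rate sums in `[Lo, Up]`, `K =
128`, `D = 2^40`). It draws NO conclusion: only the capstone `LaiKappa3SweepCert`, which needs all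
127 shard files, does. Kernel cost of this file ≈ 560 cells × 0.3 s.
-/

namespace Summit.KontsevichZagierPeriods.Zeta5Search.Sweep

set_option maxHeartbeats 100000000 in
/-- Shard 406: 80 cells of regime B from `86/219` to `145/368`.
[cite: Lai2024BallRivoal, §4 Lemma 4.3] -/
theorem shard406 :
    Shard.check 128 (2^40)
      ⟨true, 80, 86, 219, 145, 368, 19065243856232, 21551420644171⟩ = true := by
  decide +kernel

set_option maxHeartbeats 100000000 in
/-- Shard 407: 80 cells of regime B from `145/368` to `149/377`.
[cite: Lai2024BallRivoal, §4 Lemma 4.3] -/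
theorem shard407 :
    Shard.check 128 (2^40)
      ⟨true, 80, 145, 368, 149, 377, 17254950049539, 19520621494176⟩ = true := by
  decide +kernel

set_option maxHeartbeats 100000000 in
/-- Shard 408: 80 cells of regime B from `149/377` to `90/227`.
[cite: Lai2024BallRivoal, §4 Lemma 4.3] -/
theorem shard408 :
    Shard.check 128 (2^40)
      ⟨true, 80, 149, 377, 90, 227, 17865515161006, 20227345130815⟩ = true := by
  decide +kernel

set_option maxHeartbeats 100000000 in
/-- Shard 409: 80 cells of regime B from `90/227` to `138/347`.
[cite: Lai2024BallRivoal, §4 Lemma 4.3] -/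
theorem shard409 :
    Shard.check 128 (2^40)
      ⟨true, 80, 90, 227, 138, 347, 17375915598848, 19688549519137⟩ = true := by
  decide +kernel

set_option maxHeartbeats 100000000 in
/-- Shard 410: 80 cells of regime B from `138/347` to `148/371`.
[cite: Lai2024BallRivoal, §4 Lemma 4.3] -/
theorem shard410 :
    Shard.check 128 (2^40)
      ⟨true, 80, 138, 347, 148, 371, 17461641757716, 19801206052984⟩ = true := by
  decide +kernel

set_option maxHeartbeats 100000000 in
/-- Shard 411: 80 cells of regime B from `148/371` to `149/372`.
[cite: Lai2024BallRivoal, §4 Lemma 4.3] -/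
theorem shard411 :
    Shard.check 128 (2^40)
      ⟨true, 80, 148, 371, 149, 372, 22862693983891, 25953709286717⟩ = true := by
  decide +kernel

set_option maxHeartbeats 100000000 in
/-- Shard 412: 80 cells of regime B from `149/372` to `155/386`.
[cite: Lai2024BallRivoal, §4 Lemma 4.3] -/
theorem shard412 :
    Shard.check 128 (2^40)
      ⟨true, 80, 149, 372, 155, 386, 14383464599826, 16339431089616⟩ = true := by
  decide +kernel

/-- The checked shards of this file, in order. [folklore] -/
def shards058 : List (CheckedShard 128 (2^40)) :=
  [⟨_, shard406⟩, ⟨_, shard407⟩, ⟨_, shard408⟩, ⟨_, shard409⟩, ⟨_, shard410⟩,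
    ⟨_, shard411⟩, ⟨_, shard412⟩]

end Summit.KontsevichZagierPeriods.Zeta5Search.Sweep
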